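import Summits.ValiantsHypothesis.ValiantsHypothesis.Theorems.BinomialElusivePeelingLemmaGadgetSym
import Summits.ValiantsHypothesis.ValiantsHypothesis.Theorems.BinomialElusivePeelingLemmaGadgetBranch

/-!
# The theta gadget with symmetric closing, II: all arms share the branch vectors

Helper for the crux stmt-ValiantsHypothesis-7391 (negative lane; `Cruxes/PeelingLemma/DETERMINISTIC-ALLX.md`
§3d TODO(3)): `win2_b_beta`/`win2_b_eq_zero`/`win2_b_eq` and `win2_b'_beta'`/`win2_b'_eq_zero`/`win2_b'_eq` — at
positions `2q` and `4q + no + 2` every arm of the symmetric-closing gadget has the vectors `ψ_b`, `ψ_{b'}`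
(the kept letter of arm `j` is `beta' (evenAge q j)`, the other plus letters of `b'` are born in the order
`armAge q j`).  No Theses import.
-/

namespace Summit.ValiantsHypothesis.ValiantsHypothesis.Theorems.PeelingLemmaGadget

-- summit = sub-problem name (single-conjunct summit, D-0017 layout), so the namespace repeats it
set_option linter.dupNamespace false

open scoped BigOperators
open Finset
open Summit.ValiantsHypothesis.ValiantsHypothesis.Theorems.PeelingLemmaWindow (win)

variable {q no : ℕ}

/-! ## The vertex vectors at the two branch vertices -/

/-- `birth2` at an integer difference of naturals `n - i` (`i ≤ n`) is `birthNat2 (n - i)`. -/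
theorem birth2_sub_natCast (j : Fin 5) (n i : ℕ) (hi : i ≤ n) :
    birth2 q no j ((n : ℤ) - (i : ℤ)) = birthNat2 q no j (n - i) := by
  rw [← Nat.cast_sub hi, birth2_natCast]

/-- The window vector at a natural position `n ≥ 2q`, expressed through `birthNat2`. -/
theorem win_birth2_apply (j : Fin 5) (n : ℕ) (hn : 2 * q ≤ n) (ν : GLetter q no) :
    win (birth2 q no j) q (n : ℤ) ν =
      ∑ i ∈ Finset.range (2 * q + 1), (-1) ^ i * (if birthNat2 q no j (n - i) = ν then 1 else 0) := by
  unfold win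
  refine Finset.sum_congr rfl fun i hi => ?_
  rw [birth2_sub_natCast j n i (by have := Finset.mem_range.mp hi; omega)]

/-- If the letter `ν` is born at offset `i₀` below position `n` (and births are injective), its
coefficient in the window vector at `n` is `(-1)^{i₀}`. -/
theorem win2_eq_of_hit (j : Fin 5) (n : ℕ) (hn : 2 * q ≤ n) (ν : GLetter q no) (i₀ : ℕ)
    (hi₀ : i₀ ≤ 2 * q) (hit : birthNat2 q no j (n - i₀) = ν) :
    win (birth2 q no j) q (n : ℤ) ν = (-1) ^ i₀ := by
  rw [win_birth2_apply j n hn, Finset.sum_eq_single_of_mem i₀ (Finset.mem_range.mpr (by omega))]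
  · rw [if_pos hit, mul_one]
  · intro i hi hne
    rw [if_neg, mul_zero]
    intro h
    have h1 : birth2 q no j ((n - i : ℕ) : ℤ) = birth2 q no j ((n - i₀ : ℕ) : ℤ) := by
      rw [birth2_natCast, birth2_natCast, h, hit]
    have h2 := birth2_injective j h1
    have h3 : n - i = n - i₀ := by exact_mod_cast h2
    have := Finset.mem_range.mp hi
    omega

/-- A letter not born in the window below `n` does not occur in the window vector at `n`. -/
theorem win2_eq_zero_of_no_hit (j : Fin 5) (n : ℕ) (hn : 2 * q ≤ n) (ν : GLetter q no)
    (hno : ∀ i ≤ 2 * q, birthNat2 q no j (n - i) ≠ ν) : win (birth2 q no j) q (n : ℤ) ν = 0 := by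
  rw [win_birth2_apply j n hn]
  refine Finset.sum_eq_zero fun i hi => ?_
  rw [if_neg (hno i (by have := Finset.mem_range.mp hi; omega)), mul_zero]

/-- **Vertex vector at `b`.**  Every arm sees the same vector at position `2q`: the letter `beta a`
with coefficient `(-1)^a` … -/
theorem win2_b_beta (j : Fin 5) (a : Fin (2 * q + 1)) :
    win (birth2 q no j) q ((2 * q : ℕ) : ℤ) (GLetter.beta a) = (-1) ^ (a : ℕ) := by
  have hi₀ : ((armAge q j a : Fin (2 * q + 1)) : ℕ) ≤ 2 * q := by
    have := (armAge q j a).isLt; omega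
  rw [win2_eq_of_hit j (2 * q) le_rfl (GLetter.beta a) _ hi₀]
  · exact neg_one_pow_of_mod_two_eq (armAge_parity q j a)
  · rw [birthNat2_beta j (by omega)]
    have : (⟨2 * q - (2 * q - ((armAge q j a : Fin (2 * q + 1)) : ℕ)), by omega⟩ : Fin (2 * q + 1))
        = armAge q j a := Fin.ext (by simp only; omega)
    rw [this]
    simp [armAge, Equiv.swap_apply_self]

/-- … and no other letter. -/
theorem win2_b_eq_zero (j : Fin 5) (ν : GLetter q no) (hν : ∀ a, ν ≠ GLetter.beta a) :
    win (birth2 q no j) q ((2 * q : ℕ) : ℤ) ν = 0 := by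
  refine win2_eq_zero_of_no_hit j (2 * q) le_rfl ν fun i hi => ?_
  rw [birthNat2_beta j (by omega)]
  exact fun h => hν _ h.symm

/-- **Vertex vector at `b'`.**  Every arm sees the same vector at position `4q + no + 2 = 2q + L′`:
the letter `beta' a` with coefficient `(-1)^a` … -/
theorem win2_b'_beta' (j : Fin 5) (a : Fin (2 * q + 1)) :
    win (birth2 q no j) q ((4 * q + no + 2 : ℕ) : ℤ) (GLetter.beta' a) = (-1) ^ (a : ℕ) := by
  have ha := a.isLt
  have hee := evenAge_even q j
  by_cases h0 : a = evenAge q j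
  · -- the kept letter, born at `b'` itself
    rw [win2_eq_of_hit j _ (by omega) _ 0 (by omega) (by rw [Nat.sub_zero, birthNat2_kept, h0])]
    subst h0
    exact neg_one_pow_of_mod_two_eq (by rw [hee])
  by_cases hodd : (a : ℕ) % 2 = 1
  · -- a minus letter of `b'`: closing birth number `a + 1`
    have hit : birthNat2 q no j (4 * q + no + 2 - (2 * q - a)) = GLetter.beta' a := by
      rw [birthNat2_closing j (by omega) (by omega)]
      unfold closing2
      rw [if_pos (by omega)]
      congr 1; exact Fin.ext (by simp only; omega)
    rw [win2_eq_of_hit j _ (by omega) _ (2 * q - a) (by omega) hit]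
    exact neg_one_pow_of_mod_two_eq (by omega)
  · -- a plus letter of `b'` other than the kept one: closing birth number `armAge a + 1`
    have h0' : (a : ℕ) ≠ (evenAge q j : ℕ) := fun h => h0 (Fin.ext h)
    have ha2q : armAge q j a ≠ topAge q := by
      intro h
      unfold armAge at h
      rcases eq_or_ne a (topAge q) with h1 | h1
      · rw [h1, Equiv.swap_apply_left] at h
        have := congrArg Fin.val h; simp only [topAge, evenAge] at this
        apply h0; rw [h1]; exact Fin.ext (by simp only [topAge, evenAge]; omega)
      · rw [Equiv.swap_apply_of_ne_of_ne h1 h0] at h; exact h1 h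
    have hk : ((armAge q j a : Fin (2 * q + 1)) : ℕ) < 2 * q := by
      have h1 := (armAge q j a).isLt
      have h2 : ((armAge q j a : Fin (2 * q + 1)) : ℕ) ≠ 2 * q := fun h => ha2q (Fin.ext h)
      omega
    have hpar := armAge_parity q j a
    have hit : birthNat2 q no j (4 * q + no + 2 - (2 * q - ((armAge q j a : Fin (2 * q + 1)) : ℕ))) =
        GLetter.beta' a := by
      rw [birthNat2_closing j (by omega) (by omega)]
      unfold closing2
      rw [if_neg (by omega)]
      congr 1
      have : (⟨min (4 * q + no + 2 - (2 * q - ((armAge q j a : Fin (2 * q + 1)) : ℕ)) -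
          (2 * q + no + 1) - 1) (2 * q), by omega⟩ : Fin (2 * q + 1)) = armAge q j a :=
        Fin.ext (by simp only; omega)
      rw [this]; simp [armAge, Equiv.swap_apply_self]
    rw [win2_eq_of_hit j _ (by omega) _ (2 * q - ((armAge q j a : Fin (2 * q + 1)) : ℕ)) (by omega) hit]
    exact neg_one_pow_of_mod_two_eq (by omega)

/-- … and no other letter. -/
theorem win2_b'_eq_zero (j : Fin 5) (ν : GLetter q no) (hν : ∀ a, ν ≠ GLetter.beta' a) :
    win (birth2 q no j) q ((4 * q + no + 2 : ℕ) : ℤ) ν = 0 := by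
  refine win2_eq_zero_of_no_hit j _ (by omega) ν fun i hi => ?_
  rcases Nat.eq_zero_or_pos i with h0 | h0
  · subst h0; rw [Nat.sub_zero, birthNat2_kept]; exact fun h => hν _ h.symm
  · rw [birthNat2_closing j (by omega) (by omega)]
    obtain ⟨a, ha, -, -⟩ := closing2_eq_beta' (q := q) (no := no) j
      (i := 4 * q + no + 2 - i - (2 * q + no + 1)) (by omega) (by omega)
    rw [ha]; exact fun h => hν _ h.symm

/-- **Common branch vectors.**  All five arms have the same vertex vector at `b` and at `b'`. -/
theorem win2_b_eq (j j' : Fin 5) :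
    win (birth2 q no j) q ((2 * q : ℕ) : ℤ) = win (birth2 q no j') q ((2 * q : ℕ) : ℤ) := by
  funext ν
  by_cases h : ∃ a, ν = GLetter.beta a
  · obtain ⟨a, rfl⟩ := h; rw [win2_b_beta, win2_b_beta]
  · push Not at h; rw [win2_b_eq_zero j ν h, win2_b_eq_zero j' ν h]

/-- **Common branch vectors at `b'`.**  All five arms have the same vertex vector at `b' = 4q+no+2`. -/
theorem win2_b'_eq (j j' : Fin 5) :
    win (birth2 q no j) q ((4 * q + no + 2 : ℕ) : ℤ) = win (birth2 q no j') q ((4 * q + no + 2 : ℕ) : ℤ) := by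
  funext ν
  by_cases h : ∃ a, ν = GLetter.beta' a
  · obtain ⟨a, rfl⟩ := h; rw [win2_b'_beta', win2_b'_beta']
  · push Not at h; rw [win2_b'_eq_zero j ν h, win2_b'_eq_zero j' ν h]


end Summit.ValiantsHypothesis.ValiantsHypothesis.Theorems.PeelingLemmaGadget
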